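import Summits.CriticalPhenomena.PercolationContinuityZ3.Theorems.PercNearOneGluingNoHeavyLowerTailQ44PortGluing
import HarnessLib

/-!
# The terminal-pair pencil conditions of Conjecture W are STABLE UNDER THREE-PORT GLUING (the CORE of the side of `a` passes to the glued graph)

Support file for crux `stmt-CriticalPhenomena-4575` (Conjecture W = row `Q44` ∀n), seat `prim-l12-p6` gen 28; companion of `…Q44PortGluing`;
memos `run/shared/lean/prim/prim-l12/FROM-prim-l12-p6-g27-PORT-TRANSFER.md` §0 (3c) and `FROM-prim-l12-p6-g28-PORT-GLUING-LEAN.md`.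

For a three-port split `w = w₁ ⊕_{b,c,y} w₂` (`FourPointPort.IsPortSplit`) the terminal-pair pencil forms of Conjecture W (the leading coefficient of
W along a new pair between two of the ports) transfer EXACTLY as
`X_cy(w) = (q+u_b)(X_cy(w₁)·q + R_bc(w₁)·u_c + R_by(w₁)·u_y) + R_x(w₁)·(qx − u_bu_c − u_bu_y)`,
`X_by(w) = (q+u_c)(X_by(w₁)·q + R_bc(w₁)·u_b + R_cy(w₁)·u_y) + R_x(w₁)·(qx − u_cu_b − u_cu_y)`,
`X_bc(w) = (q+u_y)(X_bc(w₁)·q + R_by(w₁)·u_b + R_cy(w₁)·u_c) + R_x(w₁)·(qx − u_yu_b − u_yu_c)`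
(`(q,u_b,u_c,u_y,x)` the three-point law of the ports beyond the side; polynomial identities, `ring` on the fifteen transfer formulas), and
`qx − u_su_t − u_su_r ≥ u_tu_r ≥ 0` by Gladkov's `SK3(b,c,y)` (`Q44PendantA.sk3_bcy_cells`).  Hence:
* `ConjWPort.xcy_cells_of_portSplit` — `X_cy, R_bc, R_by ≥ 0` on the side of `a` ⇒ `X_cy(w) ≥ 0`;
* `ConjWPort.xby_cells_of_portSplit` — `X_by, R_bc ≥ 0` on the side ⇒ `X_by(w) ≥ 0` (`R_cy`, `R_x ≥ 0` are theorems);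
* `ConjWPort.xbc_cells_of_portSplit` — `X_bc, R_by ≥ 0` on the side ⇒ `X_bc(w) ≥ 0`.
* `ConjWPort.core_of_portSplit` — with `…Q44PortGluing` and `…Q44PortRowsFromPencils`: **the CORE `{W, X_cy, X_by, X_bc}` of the side of `a`
  passes to every three-port gluing of it** (the natural inductive object of the three-port cut).
No definitions, no named facts, no sorries, standard axioms.
-/

noncomputable section

namespace Summit.CriticalPhenomena.PercolationContinuityZ3.Theorems

namespace ConjWPort

open MeasureTheory Set Literature.Probability.LatticeModels Literature.Probability.Percolation
open FourPointAtoms FourPointPort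
open Summit.CriticalPhenomena.PercolationContinuityZ3.Cruxes.AdditiveGluing.TieLine.ConnAtoms
open scoped Classical

variable {n : ℕ}

/-! ### The pencil conditions are stable under three-port gluing -/

/-- **Closure of the pencil condition `X_cy` under three-port gluing**: `X_cy(w) = (q+u_b)(X_cy(w₁) q + R_bc(w₁) u_c + R_by(w₁) u_y) +
        R_x(w₁)(qx − u_bu_c − u_bu_y)`, hence `X_cy(w) ≥ 0` from `X_cy, R_bc, R_by ≥ 0` on the side of `a`, the theorem `R_x ≥ 0` and `SK3` beyond the ports (memo §0 (3c)). [this work] -/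
theorem xcy_cells_of_portSplit {D₁ D₂ : Finset (Sym2 (Fin n))} {w w₁ w₂ : Sym2 (Fin n) → unitInterval} {a b c y : Fin n}
    (h : FourPointPort.IsPortSplit D₁ D₂ w w₁ w₂ a b c y)
    (hXcy : 0 ≤ 2 * cell w₁ a b c y 0 * cell w₁ a b c y 9 + 2 * cell w₁ a b c y 0 * cell w₁ a b c y 11 + cell w₁ a b c y 0 * cell w₁ a b c y 12 +
        cell w₁ a b c y 0 * cell w₁ a b c y 13 + 2 * cell w₁ a b c y 0 * cell w₁ a b c y 14 - (2 * cell w₁ a b c y 1 * cell w₁ a b c y 6 +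
        2 * cell w₁ a b c y 1 * cell w₁ a b c y 8 + cell w₁ a b c y 1 * cell w₁ a b c y 12 + cell w₁ a b c y 1 * cell w₁ a b c y 13 +
        cell w₁ a b c y 2 * cell w₁ a b c y 4 + 2 * cell w₁ a b c y 2 * cell w₁ a b c y 5 + cell w₁ a b c y 2 * cell w₁ a b c y 6 +
        cell w₁ a b c y 2 * cell w₁ a b c y 10 + cell w₁ a b c y 3 * cell w₁ a b c y 5 + cell w₁ a b c y 3 * cell w₁ a b c y 6 +
        cell w₁ a b c y 4 * cell w₁ a b c y 6 + cell w₁ a b c y 5 * cell w₁ a b c y 6 + cell w₁ a b c y 5 * cell w₁ a b c y 7 +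
        cell w₁ a b c y 6 * cell w₁ a b c y 7 + 2 * cell w₁ a b c y 6 * cell w₁ a b c y 8 + 2 * cell w₁ a b c y 6 * cell w₁ a b c y 9 +
        cell w₁ a b c y 6 * cell w₁ a b c y 10 + 2 * cell w₁ a b c y 8 * cell w₁ a b c y 11 + 2 * cell w₁ a b c y 9 * cell w₁ a b c y 11))
    (hRbc : 0 ≤ 2 * cell w₁ a b c y 0 * cell w₁ a b c y 8 + 2 * cell w₁ a b c y 0 * cell w₁ a b c y 9 + cell w₁ a b c y 0 * cell w₁ a b c y 10 +
        2 * cell w₁ a b c y 0 * cell w₁ a b c y 11 + cell w₁ a b c y 0 * cell w₁ a b c y 12 + 2 * cell w₁ a b c y 0 * cell w₁ a b c y 13 +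
        2 * cell w₁ a b c y 0 * cell w₁ a b c y 14 - (cell w₁ a b c y 1 * cell w₁ a b c y 4 + cell w₁ a b c y 1 * cell w₁ a b c y 5 +
        2 * cell w₁ a b c y 1 * cell w₁ a b c y 6 + cell w₁ a b c y 1 * cell w₁ a b c y 12 + cell w₁ a b c y 2 * cell w₁ a b c y 4 +
        2 * cell w₁ a b c y 2 * cell w₁ a b c y 5 + cell w₁ a b c y 2 * cell w₁ a b c y 6 + cell w₁ a b c y 2 * cell w₁ a b c y 10 +
        cell w₁ a b c y 3 * cell w₁ a b c y 5 + cell w₁ a b c y 3 * cell w₁ a b c y 6 + 2 * cell w₁ a b c y 5 * cell w₁ a b c y 6 +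
        cell w₁ a b c y 5 * cell w₁ a b c y 7 + 2 * cell w₁ a b c y 5 * cell w₁ a b c y 11 + cell w₁ a b c y 6 * cell w₁ a b c y 7 +
        2 * cell w₁ a b c y 6 * cell w₁ a b c y 9 + 2 * cell w₁ a b c y 9 * cell w₁ a b c y 11))
    (hRby : 0 ≤ 2 * cell w₁ a b c y 0 * cell w₁ a b c y 9 + 2 * cell w₁ a b c y 0 * cell w₁ a b c y 10 + 2 * cell w₁ a b c y 0 * cell w₁ a b c y 11 +
        2 * cell w₁ a b c y 0 * cell w₁ a b c y 12 + cell w₁ a b c y 0 * cell w₁ a b c y 13 +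
        2 * cell w₁ a b c y 0 * cell w₁ a b c y 14 - (2 * cell w₁ a b c y 1 * cell w₁ a b c y 4 + 2 * cell w₁ a b c y 1 * cell w₁ a b c y 5 +
        2 * cell w₁ a b c y 1 * cell w₁ a b c y 6 + 2 * cell w₁ a b c y 1 * cell w₁ a b c y 8 + cell w₁ a b c y 1 * cell w₁ a b c y 13 +
        cell w₁ a b c y 2 * cell w₁ a b c y 5 + cell w₁ a b c y 2 * cell w₁ a b c y 6 + cell w₁ a b c y 3 * cell w₁ a b c y 5 +
        cell w₁ a b c y 3 * cell w₁ a b c y 6 + 2 * cell w₁ a b c y 4 * cell w₁ a b c y 6 + 2 * cell w₁ a b c y 4 * cell w₁ a b c y 11 +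
        cell w₁ a b c y 5 * cell w₁ a b c y 7 + cell w₁ a b c y 6 * cell w₁ a b c y 7 + 2 * cell w₁ a b c y 6 * cell w₁ a b c y 8 +
        2 * cell w₁ a b c y 8 * cell w₁ a b c y 11)) :
    0 ≤ 2 * cell w a b c y 0 * cell w a b c y 9 + 2 * cell w a b c y 0 * cell w a b c y 11 + cell w a b c y 0 * cell w a b c y 12 +
        cell w a b c y 0 * cell w a b c y 13 + 2 * cell w a b c y 0 * cell w a b c y 14 - (2 * cell w a b c y 1 * cell w a b c y 6 +
        2 * cell w a b c y 1 * cell w a b c y 8 + cell w a b c y 1 * cell w a b c y 12 + cell w a b c y 1 * cell w a b c y 13 +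
        cell w a b c y 2 * cell w a b c y 4 + 2 * cell w a b c y 2 * cell w a b c y 5 + cell w a b c y 2 * cell w a b c y 6 +
        cell w a b c y 2 * cell w a b c y 10 + cell w a b c y 3 * cell w a b c y 5 + cell w a b c y 3 * cell w a b c y 6 +
        cell w a b c y 4 * cell w a b c y 6 + cell w a b c y 5 * cell w a b c y 6 + cell w a b c y 5 * cell w a b c y 7 +
        cell w a b c y 6 * cell w a b c y 7 + 2 * cell w a b c y 6 * cell w a b c y 8 + 2 * cell w a b c y 6 * cell w a b c y 9 +
        cell w a b c y 6 * cell w a b c y 10 + 2 * cell w a b c y 8 * cell w a b c y 11 + 2 * cell w a b c y 9 * cell w a b c y 11) := by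
  obtain ⟨z4, z5, z6, z8, z9, z10, z11, z12, z13, z14⟩ := h.far_cells
  have hRx := portRow_x_cells w₁ a b c y
  have hRcy := portRow_cy_cells w₁ a b c y
  have hsk := Q44PendantA.sk3_bcy_cells w₂ a b c y
  rw [z4, z5, z6, z8, z9, z10, z11, z12, z13, z14] at hsk
  simp only [add_zero] at hsk
  have q0 := cell_nonneg w₂ a b c y 0; have q1 := cell_nonneg w₂ a b c y 1; have q2 := cell_nonneg w₂ a b c y 2
  have q3 := cell_nonneg w₂ a b c y 3
  have t1 : 0 ≤ (cell w₂ a b c y 0 + cell w₂ a b c y 1) * ((2 * cell w₁ a b c y 0 * cell w₁ a b c y 9 + 2 * cell w₁ a b c y 0 * cell w₁ a b c y 11 +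
        cell w₁ a b c y 0 * cell w₁ a b c y 12 + cell w₁ a b c y 0 * cell w₁ a b c y 13 +
        2 * cell w₁ a b c y 0 * cell w₁ a b c y 14 - (2 * cell w₁ a b c y 1 * cell w₁ a b c y 6 + 2 * cell w₁ a b c y 1 * cell w₁ a b c y 8 +
        cell w₁ a b c y 1 * cell w₁ a b c y 12 + cell w₁ a b c y 1 * cell w₁ a b c y 13 + cell w₁ a b c y 2 * cell w₁ a b c y 4 +
        2 * cell w₁ a b c y 2 * cell w₁ a b c y 5 + cell w₁ a b c y 2 * cell w₁ a b c y 6 + cell w₁ a b c y 2 * cell w₁ a b c y 10 +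
        cell w₁ a b c y 3 * cell w₁ a b c y 5 + cell w₁ a b c y 3 * cell w₁ a b c y 6 + cell w₁ a b c y 4 * cell w₁ a b c y 6 +
        cell w₁ a b c y 5 * cell w₁ a b c y 6 + cell w₁ a b c y 5 * cell w₁ a b c y 7 + cell w₁ a b c y 6 * cell w₁ a b c y 7 +
        2 * cell w₁ a b c y 6 * cell w₁ a b c y 8 + 2 * cell w₁ a b c y 6 * cell w₁ a b c y 9 + cell w₁ a b c y 6 * cell w₁ a b c y 10 +
        2 * cell w₁ a b c y 8 * cell w₁ a b c y 11 + 2 * cell w₁ a b c y 9 * cell w₁ a b c y 11)) * cell w₂ a b c y 0) :=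
    mul_nonneg (add_nonneg q0 q1) (mul_nonneg hXcy q0)
  have t2 : 0 ≤ (cell w₂ a b c y 0 + cell w₂ a b c y 1) * ((2 * cell w₁ a b c y 0 * cell w₁ a b c y 8 + 2 * cell w₁ a b c y 0 * cell w₁ a b c y 9 +
        cell w₁ a b c y 0 * cell w₁ a b c y 10 + 2 * cell w₁ a b c y 0 * cell w₁ a b c y 11 + cell w₁ a b c y 0 * cell w₁ a b c y 12 +
        2 * cell w₁ a b c y 0 * cell w₁ a b c y 13 + 2 * cell w₁ a b c y 0 * cell w₁ a b c y 14 - (cell w₁ a b c y 1 * cell w₁ a b c y 4 +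
        cell w₁ a b c y 1 * cell w₁ a b c y 5 + 2 * cell w₁ a b c y 1 * cell w₁ a b c y 6 + cell w₁ a b c y 1 * cell w₁ a b c y 12 +
        cell w₁ a b c y 2 * cell w₁ a b c y 4 + 2 * cell w₁ a b c y 2 * cell w₁ a b c y 5 + cell w₁ a b c y 2 * cell w₁ a b c y 6 +
        cell w₁ a b c y 2 * cell w₁ a b c y 10 + cell w₁ a b c y 3 * cell w₁ a b c y 5 + cell w₁ a b c y 3 * cell w₁ a b c y 6 +
        2 * cell w₁ a b c y 5 * cell w₁ a b c y 6 + cell w₁ a b c y 5 * cell w₁ a b c y 7 + 2 * cell w₁ a b c y 5 * cell w₁ a b c y 11 +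
        cell w₁ a b c y 6 * cell w₁ a b c y 7 + 2 * cell w₁ a b c y 6 * cell w₁ a b c y 9 +
        2 * cell w₁ a b c y 9 * cell w₁ a b c y 11)) * cell w₂ a b c y 2) :=
    mul_nonneg (add_nonneg q0 q1) (mul_nonneg hRbc q2)
  have t3 : 0 ≤ (cell w₂ a b c y 0 + cell w₂ a b c y 1) * ((2 * cell w₁ a b c y 0 * cell w₁ a b c y 9 + 2 * cell w₁ a b c y 0 * cell w₁ a b c y 10 +
        2 * cell w₁ a b c y 0 * cell w₁ a b c y 11 + 2 * cell w₁ a b c y 0 * cell w₁ a b c y 12 + cell w₁ a b c y 0 * cell w₁ a b c y 13 +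
        2 * cell w₁ a b c y 0 * cell w₁ a b c y 14 - (2 * cell w₁ a b c y 1 * cell w₁ a b c y 4 + 2 * cell w₁ a b c y 1 * cell w₁ a b c y 5 +
        2 * cell w₁ a b c y 1 * cell w₁ a b c y 6 + 2 * cell w₁ a b c y 1 * cell w₁ a b c y 8 + cell w₁ a b c y 1 * cell w₁ a b c y 13 +
        cell w₁ a b c y 2 * cell w₁ a b c y 5 + cell w₁ a b c y 2 * cell w₁ a b c y 6 + cell w₁ a b c y 3 * cell w₁ a b c y 5 +
        cell w₁ a b c y 3 * cell w₁ a b c y 6 + 2 * cell w₁ a b c y 4 * cell w₁ a b c y 6 + 2 * cell w₁ a b c y 4 * cell w₁ a b c y 11 +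
        cell w₁ a b c y 5 * cell w₁ a b c y 7 + cell w₁ a b c y 6 * cell w₁ a b c y 7 + 2 * cell w₁ a b c y 6 * cell w₁ a b c y 8 +
        2 * cell w₁ a b c y 8 * cell w₁ a b c y 11)) * cell w₂ a b c y 3) :=
    mul_nonneg (add_nonneg q0 q1) (mul_nonneg hRby q3)
  have t4 : 0 ≤ (2 * (cell w₁ a b c y 0 * (cell w₁ a b c y 4 + cell w₁ a b c y 5 + cell w₁ a b c y 6 + cell w₁ a b c y 8 + cell w₁ a b c y 9 +
        cell w₁ a b c y 10 + cell w₁ a b c y 11 + cell w₁ a b c y 12 + cell w₁ a b c y 13 + cell w₁ a b c y 14)) - (cell w₁ a b c y 0 +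
        cell w₁ a b c y 1 + cell w₁ a b c y 2 + cell w₁ a b c y 3 + cell w₁ a b c y 7) * (cell w₁ a b c y 5 + cell w₁ a b c y 6)) *
      ((cell w₂ a b c y 7 * cell w₂ a b c y 0 - cell w₂ a b c y 3 * cell w₂ a b c y 2 - cell w₂ a b c y 3 * cell w₂ a b c y 1 - cell w₂ a b c y 2 * cell w₂ a b c y 1) +
        cell w₂ a b c y 2 * cell w₂ a b c y 3) :=
    mul_nonneg (by linarith) (add_nonneg (by linarith) (mul_nonneg q2 q3))
  rw [h.cell0_eq, h.cell1_eq, h.cell2_eq, h.cell3_eq, h.cell4_eq, h.cell5_eq, h.cell6_eq, h.cell7_eq, h.cell8_eq, h.cell9_eq, h.cell10_eq, h.cell11_eq, h.cell12_eq, h.cell13_eq, h.cell14_eq]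
  linarith [t1, t2, t3, t4]

/-- **Closure of the pencil condition `X_by` under three-port gluing**: `X_by(w) = (q+u_c)(X_by(w₁) q + R_bc(w₁) u_b + R_cy(w₁) u_y) +
        R_x(w₁)(qx − u_cu_b − u_cu_y)` (`R_cy, R_x ≥ 0` are theorems). [this work] -/
theorem xby_cells_of_portSplit {D₁ D₂ : Finset (Sym2 (Fin n))} {w w₁ w₂ : Sym2 (Fin n) → unitInterval} {a b c y : Fin n}
    (h : FourPointPort.IsPortSplit D₁ D₂ w w₁ w₂ a b c y)
    (hXby : 0 ≤ 2 * cell w₁ a b c y 0 * cell w₁ a b c y 8 + cell w₁ a b c y 0 * cell w₁ a b c y 10 + 2 * cell w₁ a b c y 0 * cell w₁ a b c y 11 +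
        cell w₁ a b c y 0 * cell w₁ a b c y 13 + 2 * cell w₁ a b c y 0 * cell w₁ a b c y 14 - (cell w₁ a b c y 1 * cell w₁ a b c y 4 +
        cell w₁ a b c y 1 * cell w₁ a b c y 5 + 2 * cell w₁ a b c y 1 * cell w₁ a b c y 6 + cell w₁ a b c y 1 * cell w₁ a b c y 12 +
        cell w₁ a b c y 2 * cell w₁ a b c y 10 + cell w₁ a b c y 2 * cell w₁ a b c y 13 + cell w₁ a b c y 3 * cell w₁ a b c y 5 +
        cell w₁ a b c y 3 * cell w₁ a b c y 6 + cell w₁ a b c y 4 * cell w₁ a b c y 5 + cell w₁ a b c y 5 * cell w₁ a b c y 6 +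
        cell w₁ a b c y 5 * cell w₁ a b c y 7 + 2 * cell w₁ a b c y 5 * cell w₁ a b c y 11 + cell w₁ a b c y 5 * cell w₁ a b c y 12 +
        cell w₁ a b c y 6 * cell w₁ a b c y 7 + 2 * cell w₁ a b c y 9 * cell w₁ a b c y 11))
    (hRbc : 0 ≤ 2 * cell w₁ a b c y 0 * cell w₁ a b c y 8 + 2 * cell w₁ a b c y 0 * cell w₁ a b c y 9 + cell w₁ a b c y 0 * cell w₁ a b c y 10 +
        2 * cell w₁ a b c y 0 * cell w₁ a b c y 11 + cell w₁ a b c y 0 * cell w₁ a b c y 12 + 2 * cell w₁ a b c y 0 * cell w₁ a b c y 13 +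
        2 * cell w₁ a b c y 0 * cell w₁ a b c y 14 - (cell w₁ a b c y 1 * cell w₁ a b c y 4 + cell w₁ a b c y 1 * cell w₁ a b c y 5 +
        2 * cell w₁ a b c y 1 * cell w₁ a b c y 6 + cell w₁ a b c y 1 * cell w₁ a b c y 12 + cell w₁ a b c y 2 * cell w₁ a b c y 4 +
        2 * cell w₁ a b c y 2 * cell w₁ a b c y 5 + cell w₁ a b c y 2 * cell w₁ a b c y 6 + cell w₁ a b c y 2 * cell w₁ a b c y 10 +
        cell w₁ a b c y 3 * cell w₁ a b c y 5 + cell w₁ a b c y 3 * cell w₁ a b c y 6 + 2 * cell w₁ a b c y 5 * cell w₁ a b c y 6 +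
        cell w₁ a b c y 5 * cell w₁ a b c y 7 + 2 * cell w₁ a b c y 5 * cell w₁ a b c y 11 + cell w₁ a b c y 6 * cell w₁ a b c y 7 +
        2 * cell w₁ a b c y 6 * cell w₁ a b c y 9 + 2 * cell w₁ a b c y 9 * cell w₁ a b c y 11)) :
    0 ≤ 2 * cell w a b c y 0 * cell w a b c y 8 + cell w a b c y 0 * cell w a b c y 10 + 2 * cell w a b c y 0 * cell w a b c y 11 +
        cell w a b c y 0 * cell w a b c y 13 + 2 * cell w a b c y 0 * cell w a b c y 14 - (cell w a b c y 1 * cell w a b c y 4 +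
        cell w a b c y 1 * cell w a b c y 5 + 2 * cell w a b c y 1 * cell w a b c y 6 + cell w a b c y 1 * cell w a b c y 12 +
        cell w a b c y 2 * cell w a b c y 10 + cell w a b c y 2 * cell w a b c y 13 + cell w a b c y 3 * cell w a b c y 5 +
        cell w a b c y 3 * cell w a b c y 6 + cell w a b c y 4 * cell w a b c y 5 + cell w a b c y 5 * cell w a b c y 6 +
        cell w a b c y 5 * cell w a b c y 7 + 2 * cell w a b c y 5 * cell w a b c y 11 + cell w a b c y 5 * cell w a b c y 12 +
        cell w a b c y 6 * cell w a b c y 7 + 2 * cell w a b c y 9 * cell w a b c y 11) := by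
  obtain ⟨z4, z5, z6, z8, z9, z10, z11, z12, z13, z14⟩ := h.far_cells
  have hRx := portRow_x_cells w₁ a b c y
  have hRcy := portRow_cy_cells w₁ a b c y
  have hsk := Q44PendantA.sk3_bcy_cells w₂ a b c y
  rw [z4, z5, z6, z8, z9, z10, z11, z12, z13, z14] at hsk
  simp only [add_zero] at hsk
  have q0 := cell_nonneg w₂ a b c y 0; have q1 := cell_nonneg w₂ a b c y 1; have q2 := cell_nonneg w₂ a b c y 2
  have q3 := cell_nonneg w₂ a b c y 3
  have t1 : 0 ≤ (cell w₂ a b c y 0 + cell w₂ a b c y 2) * ((2 * cell w₁ a b c y 0 * cell w₁ a b c y 8 + cell w₁ a b c y 0 * cell w₁ a b c y 10 +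
        2 * cell w₁ a b c y 0 * cell w₁ a b c y 11 + cell w₁ a b c y 0 * cell w₁ a b c y 13 +
        2 * cell w₁ a b c y 0 * cell w₁ a b c y 14 - (cell w₁ a b c y 1 * cell w₁ a b c y 4 + cell w₁ a b c y 1 * cell w₁ a b c y 5 +
        2 * cell w₁ a b c y 1 * cell w₁ a b c y 6 + cell w₁ a b c y 1 * cell w₁ a b c y 12 + cell w₁ a b c y 2 * cell w₁ a b c y 10 +
        cell w₁ a b c y 2 * cell w₁ a b c y 13 + cell w₁ a b c y 3 * cell w₁ a b c y 5 + cell w₁ a b c y 3 * cell w₁ a b c y 6 +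
        cell w₁ a b c y 4 * cell w₁ a b c y 5 + cell w₁ a b c y 5 * cell w₁ a b c y 6 + cell w₁ a b c y 5 * cell w₁ a b c y 7 +
        2 * cell w₁ a b c y 5 * cell w₁ a b c y 11 + cell w₁ a b c y 5 * cell w₁ a b c y 12 + cell w₁ a b c y 6 * cell w₁ a b c y 7 +
        2 * cell w₁ a b c y 9 * cell w₁ a b c y 11)) * cell w₂ a b c y 0) :=
    mul_nonneg (add_nonneg q0 q2) (mul_nonneg hXby q0)
  have t2 : 0 ≤ (cell w₂ a b c y 0 + cell w₂ a b c y 2) * ((2 * cell w₁ a b c y 0 * cell w₁ a b c y 8 + 2 * cell w₁ a b c y 0 * cell w₁ a b c y 9 +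
        cell w₁ a b c y 0 * cell w₁ a b c y 10 + 2 * cell w₁ a b c y 0 * cell w₁ a b c y 11 + cell w₁ a b c y 0 * cell w₁ a b c y 12 +
        2 * cell w₁ a b c y 0 * cell w₁ a b c y 13 + 2 * cell w₁ a b c y 0 * cell w₁ a b c y 14 - (cell w₁ a b c y 1 * cell w₁ a b c y 4 +
        cell w₁ a b c y 1 * cell w₁ a b c y 5 + 2 * cell w₁ a b c y 1 * cell w₁ a b c y 6 + cell w₁ a b c y 1 * cell w₁ a b c y 12 +
        cell w₁ a b c y 2 * cell w₁ a b c y 4 + 2 * cell w₁ a b c y 2 * cell w₁ a b c y 5 + cell w₁ a b c y 2 * cell w₁ a b c y 6 +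
        cell w₁ a b c y 2 * cell w₁ a b c y 10 + cell w₁ a b c y 3 * cell w₁ a b c y 5 + cell w₁ a b c y 3 * cell w₁ a b c y 6 +
        2 * cell w₁ a b c y 5 * cell w₁ a b c y 6 + cell w₁ a b c y 5 * cell w₁ a b c y 7 + 2 * cell w₁ a b c y 5 * cell w₁ a b c y 11 +
        cell w₁ a b c y 6 * cell w₁ a b c y 7 + 2 * cell w₁ a b c y 6 * cell w₁ a b c y 9 +
        2 * cell w₁ a b c y 9 * cell w₁ a b c y 11)) * cell w₂ a b c y 1) :=
    mul_nonneg (add_nonneg q0 q2) (mul_nonneg hRbc q1)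
  have t3 : 0 ≤ (cell w₂ a b c y 0 + cell w₂ a b c y 2) * ((2 * (cell w₁ a b c y 0 * (cell w₁ a b c y 4 + cell w₁ a b c y 8 + cell w₁ a b c y 9 +
        cell w₁ a b c y 10 + cell w₁ a b c y 11 + cell w₁ a b c y 12 + cell w₁ a b c y 14)) +
        cell w₁ a b c y 0 * cell w₁ a b c y 13 - ((cell w₁ a b c y 5 + cell w₁ a b c y 6) * (cell w₁ a b c y 1 + 2 * cell w₁ a b c y 2 +
        cell w₁ a b c y 3 + cell w₁ a b c y 7) + cell w₁ a b c y 2 * cell w₁ a b c y 13)) * cell w₂ a b c y 3) :=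
    mul_nonneg (add_nonneg q0 q2) (mul_nonneg (by linarith) q3)
  have t4 : 0 ≤ (2 * (cell w₁ a b c y 0 * (cell w₁ a b c y 4 + cell w₁ a b c y 5 + cell w₁ a b c y 6 + cell w₁ a b c y 8 + cell w₁ a b c y 9 +
        cell w₁ a b c y 10 + cell w₁ a b c y 11 + cell w₁ a b c y 12 + cell w₁ a b c y 13 + cell w₁ a b c y 14)) - (cell w₁ a b c y 0 +
        cell w₁ a b c y 1 + cell w₁ a b c y 2 + cell w₁ a b c y 3 + cell w₁ a b c y 7) * (cell w₁ a b c y 5 + cell w₁ a b c y 6)) *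
      ((cell w₂ a b c y 7 * cell w₂ a b c y 0 - cell w₂ a b c y 3 * cell w₂ a b c y 2 - cell w₂ a b c y 3 * cell w₂ a b c y 1 - cell w₂ a b c y 2 * cell w₂ a b c y 1) +
        cell w₂ a b c y 1 * cell w₂ a b c y 3) :=
    mul_nonneg (by linarith) (add_nonneg (by linarith) (mul_nonneg q1 q3))
  rw [h.cell0_eq, h.cell1_eq, h.cell2_eq, h.cell3_eq, h.cell4_eq, h.cell5_eq, h.cell6_eq, h.cell7_eq, h.cell8_eq, h.cell9_eq, h.cell10_eq, h.cell11_eq, h.cell12_eq, h.cell13_eq, h.cell14_eq]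
  linarith [t1, t2, t3, t4]

/-- **Closure of the pencil condition `X_bc` under three-port gluing**: `X_bc(w) = (q+u_y)(X_bc(w₁) q + R_by(w₁) u_b + R_cy(w₁) u_c) +
        R_x(w₁)(qx − u_yu_b − u_yu_c)`. [this work] -/
theorem xbc_cells_of_portSplit {D₁ D₂ : Finset (Sym2 (Fin n))} {w w₁ w₂ : Sym2 (Fin n) → unitInterval} {a b c y : Fin n}
    (h : FourPointPort.IsPortSplit D₁ D₂ w w₁ w₂ a b c y)
    (hXbc : 0 ≤ 2 * cell w₁ a b c y 0 * cell w₁ a b c y 9 + 2 * cell w₁ a b c y 0 * cell w₁ a b c y 10 + 2 * cell w₁ a b c y 0 * cell w₁ a b c y 11 +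
        2 * cell w₁ a b c y 0 * cell w₁ a b c y 12 + 2 * cell w₁ a b c y 0 * cell w₁ a b c y 14 - (2 * cell w₁ a b c y 1 * cell w₁ a b c y 4 +
        2 * cell w₁ a b c y 1 * cell w₁ a b c y 5 + 2 * cell w₁ a b c y 1 * cell w₁ a b c y 6 + 2 * cell w₁ a b c y 1 * cell w₁ a b c y 8 +
        cell w₁ a b c y 1 * cell w₁ a b c y 13 + 2 * cell w₁ a b c y 2 * cell w₁ a b c y 5 + 2 * cell w₁ a b c y 2 * cell w₁ a b c y 6 +
        cell w₁ a b c y 2 * cell w₁ a b c y 13 + 2 * cell w₁ a b c y 4 * cell w₁ a b c y 6 + 2 * cell w₁ a b c y 4 * cell w₁ a b c y 11 +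
        cell w₁ a b c y 5 * cell w₁ a b c y 7 + cell w₁ a b c y 6 * cell w₁ a b c y 7 + 2 * cell w₁ a b c y 6 * cell w₁ a b c y 8 +
        2 * cell w₁ a b c y 8 * cell w₁ a b c y 11))
    (hRby : 0 ≤ 2 * cell w₁ a b c y 0 * cell w₁ a b c y 9 + 2 * cell w₁ a b c y 0 * cell w₁ a b c y 10 + 2 * cell w₁ a b c y 0 * cell w₁ a b c y 11 +
        2 * cell w₁ a b c y 0 * cell w₁ a b c y 12 + cell w₁ a b c y 0 * cell w₁ a b c y 13 +
        2 * cell w₁ a b c y 0 * cell w₁ a b c y 14 - (2 * cell w₁ a b c y 1 * cell w₁ a b c y 4 + 2 * cell w₁ a b c y 1 * cell w₁ a b c y 5 +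
        2 * cell w₁ a b c y 1 * cell w₁ a b c y 6 + 2 * cell w₁ a b c y 1 * cell w₁ a b c y 8 + cell w₁ a b c y 1 * cell w₁ a b c y 13 +
        cell w₁ a b c y 2 * cell w₁ a b c y 5 + cell w₁ a b c y 2 * cell w₁ a b c y 6 + cell w₁ a b c y 3 * cell w₁ a b c y 5 +
        cell w₁ a b c y 3 * cell w₁ a b c y 6 + 2 * cell w₁ a b c y 4 * cell w₁ a b c y 6 + 2 * cell w₁ a b c y 4 * cell w₁ a b c y 11 +
        cell w₁ a b c y 5 * cell w₁ a b c y 7 + cell w₁ a b c y 6 * cell w₁ a b c y 7 + 2 * cell w₁ a b c y 6 * cell w₁ a b c y 8 +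
        2 * cell w₁ a b c y 8 * cell w₁ a b c y 11)) :
    0 ≤ 2 * cell w a b c y 0 * cell w a b c y 9 + 2 * cell w a b c y 0 * cell w a b c y 10 + 2 * cell w a b c y 0 * cell w a b c y 11 +
        2 * cell w a b c y 0 * cell w a b c y 12 + 2 * cell w a b c y 0 * cell w a b c y 14 - (2 * cell w a b c y 1 * cell w a b c y 4 +
        2 * cell w a b c y 1 * cell w a b c y 5 + 2 * cell w a b c y 1 * cell w a b c y 6 + 2 * cell w a b c y 1 * cell w a b c y 8 +
        cell w a b c y 1 * cell w a b c y 13 + 2 * cell w a b c y 2 * cell w a b c y 5 + 2 * cell w a b c y 2 * cell w a b c y 6 +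
        cell w a b c y 2 * cell w a b c y 13 + 2 * cell w a b c y 4 * cell w a b c y 6 + 2 * cell w a b c y 4 * cell w a b c y 11 +
        cell w a b c y 5 * cell w a b c y 7 + cell w a b c y 6 * cell w a b c y 7 + 2 * cell w a b c y 6 * cell w a b c y 8 +
        2 * cell w a b c y 8 * cell w a b c y 11) := by
  obtain ⟨z4, z5, z6, z8, z9, z10, z11, z12, z13, z14⟩ := h.far_cells
  have hRx := portRow_x_cells w₁ a b c y
  have hRcy := portRow_cy_cells w₁ a b c y
  have hsk := Q44PendantA.sk3_bcy_cells w₂ a b c y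
  rw [z4, z5, z6, z8, z9, z10, z11, z12, z13, z14] at hsk
  simp only [add_zero] at hsk
  have q0 := cell_nonneg w₂ a b c y 0; have q1 := cell_nonneg w₂ a b c y 1; have q2 := cell_nonneg w₂ a b c y 2
  have q3 := cell_nonneg w₂ a b c y 3
  have t1 : 0 ≤ (cell w₂ a b c y 0 + cell w₂ a b c y 3) * ((2 * cell w₁ a b c y 0 * cell w₁ a b c y 9 + 2 * cell w₁ a b c y 0 * cell w₁ a b c y 10 +
        2 * cell w₁ a b c y 0 * cell w₁ a b c y 11 + 2 * cell w₁ a b c y 0 * cell w₁ a b c y 12 +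
        2 * cell w₁ a b c y 0 * cell w₁ a b c y 14 - (2 * cell w₁ a b c y 1 * cell w₁ a b c y 4 + 2 * cell w₁ a b c y 1 * cell w₁ a b c y 5 +
        2 * cell w₁ a b c y 1 * cell w₁ a b c y 6 + 2 * cell w₁ a b c y 1 * cell w₁ a b c y 8 + cell w₁ a b c y 1 * cell w₁ a b c y 13 +
        2 * cell w₁ a b c y 2 * cell w₁ a b c y 5 + 2 * cell w₁ a b c y 2 * cell w₁ a b c y 6 + cell w₁ a b c y 2 * cell w₁ a b c y 13 +
        2 * cell w₁ a b c y 4 * cell w₁ a b c y 6 + 2 * cell w₁ a b c y 4 * cell w₁ a b c y 11 + cell w₁ a b c y 5 * cell w₁ a b c y 7 +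
        cell w₁ a b c y 6 * cell w₁ a b c y 7 + 2 * cell w₁ a b c y 6 * cell w₁ a b c y 8 +
        2 * cell w₁ a b c y 8 * cell w₁ a b c y 11)) * cell w₂ a b c y 0) :=
    mul_nonneg (add_nonneg q0 q3) (mul_nonneg hXbc q0)
  have t2 : 0 ≤ (cell w₂ a b c y 0 + cell w₂ a b c y 3) * ((2 * cell w₁ a b c y 0 * cell w₁ a b c y 9 + 2 * cell w₁ a b c y 0 * cell w₁ a b c y 10 +
        2 * cell w₁ a b c y 0 * cell w₁ a b c y 11 + 2 * cell w₁ a b c y 0 * cell w₁ a b c y 12 + cell w₁ a b c y 0 * cell w₁ a b c y 13 +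
        2 * cell w₁ a b c y 0 * cell w₁ a b c y 14 - (2 * cell w₁ a b c y 1 * cell w₁ a b c y 4 + 2 * cell w₁ a b c y 1 * cell w₁ a b c y 5 +
        2 * cell w₁ a b c y 1 * cell w₁ a b c y 6 + 2 * cell w₁ a b c y 1 * cell w₁ a b c y 8 + cell w₁ a b c y 1 * cell w₁ a b c y 13 +
        cell w₁ a b c y 2 * cell w₁ a b c y 5 + cell w₁ a b c y 2 * cell w₁ a b c y 6 + cell w₁ a b c y 3 * cell w₁ a b c y 5 +
        cell w₁ a b c y 3 * cell w₁ a b c y 6 + 2 * cell w₁ a b c y 4 * cell w₁ a b c y 6 + 2 * cell w₁ a b c y 4 * cell w₁ a b c y 11 +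
        cell w₁ a b c y 5 * cell w₁ a b c y 7 + cell w₁ a b c y 6 * cell w₁ a b c y 7 + 2 * cell w₁ a b c y 6 * cell w₁ a b c y 8 +
        2 * cell w₁ a b c y 8 * cell w₁ a b c y 11)) * cell w₂ a b c y 1) :=
    mul_nonneg (add_nonneg q0 q3) (mul_nonneg hRby q1)
  have t3 : 0 ≤ (cell w₂ a b c y 0 + cell w₂ a b c y 3) * ((2 * (cell w₁ a b c y 0 * (cell w₁ a b c y 4 + cell w₁ a b c y 8 + cell w₁ a b c y 9 +
        cell w₁ a b c y 10 + cell w₁ a b c y 11 + cell w₁ a b c y 12 + cell w₁ a b c y 14)) +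
        cell w₁ a b c y 0 * cell w₁ a b c y 13 - ((cell w₁ a b c y 5 + cell w₁ a b c y 6) * (cell w₁ a b c y 1 + 2 * cell w₁ a b c y 2 +
        cell w₁ a b c y 3 + cell w₁ a b c y 7) + cell w₁ a b c y 2 * cell w₁ a b c y 13)) * cell w₂ a b c y 2) :=
    mul_nonneg (add_nonneg q0 q3) (mul_nonneg (by linarith) q2)
  have t4 : 0 ≤ (2 * (cell w₁ a b c y 0 * (cell w₁ a b c y 4 + cell w₁ a b c y 5 + cell w₁ a b c y 6 + cell w₁ a b c y 8 + cell w₁ a b c y 9 +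
        cell w₁ a b c y 10 + cell w₁ a b c y 11 + cell w₁ a b c y 12 + cell w₁ a b c y 13 + cell w₁ a b c y 14)) - (cell w₁ a b c y 0 +
        cell w₁ a b c y 1 + cell w₁ a b c y 2 + cell w₁ a b c y 3 + cell w₁ a b c y 7) * (cell w₁ a b c y 5 + cell w₁ a b c y 6)) *
      ((cell w₂ a b c y 7 * cell w₂ a b c y 0 - cell w₂ a b c y 3 * cell w₂ a b c y 2 - cell w₂ a b c y 3 * cell w₂ a b c y 1 - cell w₂ a b c y 2 * cell w₂ a b c y 1) +
        cell w₂ a b c y 1 * cell w₂ a b c y 2) :=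
    mul_nonneg (by linarith) (add_nonneg (by linarith) (mul_nonneg q1 q2))
  rw [h.cell0_eq, h.cell1_eq, h.cell2_eq, h.cell4_eq, h.cell5_eq, h.cell6_eq, h.cell7_eq, h.cell8_eq, h.cell9_eq, h.cell10_eq, h.cell11_eq, h.cell12_eq, h.cell13_eq, h.cell14_eq]
  linarith [t1, t2, t3, t4]


/-- **THE CORE IS STABLE UNDER THREE-PORT GLUING.**  If the side of `a` satisfies Conjecture W and its three terminal-pair pencil conditions
`X_cy, X_by, X_bc ≥ 0` (the CORE), then so does every three-port gluing of it (`…Q44PortGluing` for W; this file for the pencils; the port rows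
`R_bc, R_by` of the side come from `…Q44PortRowsFromPencils`).  So the CORE is the natural inductive object of the three-port cut, and a minimal
counterexample to Conjecture W (for the order "number of vertices, then number of pairs of positive weight") is three-port-inseparable at each
of its four terminals (memo g27 §0 (7)). [this work] -/
theorem core_of_portSplit {D₁ D₂ : Finset (Sym2 (Fin n))} {w w₁ w₂ : Sym2 (Fin n) → unitInterval} {a b c y : Fin n}
    (h : FourPointPort.IsPortSplit D₁ D₂ w w₁ w₂ a b c y)
    (hW : 2 * (cell w₁ a b c y 11 * cell w₁ a b c y 9 + cell w₁ a b c y 11 * cell w₁ a b c y 8 + cell w₁ a b c y 6 * cell w₁ a b c y 8 +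
        cell w₁ a b c y 6 * cell w₁ a b c y 1 + cell w₁ a b c y 1 * cell w₁ a b c y 8) +
        (cell w₁ a b c y 2 * cell w₁ a b c y 13 + cell w₁ a b c y 1 * cell w₁ a b c y 13 + cell w₁ a b c y 5 * cell w₁ a b c y 12 +
        cell w₁ a b c y 1 * cell w₁ a b c y 12 + cell w₁ a b c y 6 * cell w₁ a b c y 10 + cell w₁ a b c y 6 * cell w₁ a b c y 7 +
          cell w₁ a b c y 2 * cell w₁ a b c y 10 + cell w₁ a b c y 5 * cell w₁ a b c y 7) ≤
      2 * ((cell w₁ a b c y 11 + cell w₁ a b c y 14) * cell w₁ a b c y 0))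
    (hXcy : 0 ≤ 2 * cell w₁ a b c y 0 * cell w₁ a b c y 9 + 2 * cell w₁ a b c y 0 * cell w₁ a b c y 11 + cell w₁ a b c y 0 * cell w₁ a b c y 12 +
        cell w₁ a b c y 0 * cell w₁ a b c y 13 + 2 * cell w₁ a b c y 0 * cell w₁ a b c y 14 - (2 * cell w₁ a b c y 1 * cell w₁ a b c y 6 +
        2 * cell w₁ a b c y 1 * cell w₁ a b c y 8 + cell w₁ a b c y 1 * cell w₁ a b c y 12 + cell w₁ a b c y 1 * cell w₁ a b c y 13 +
        cell w₁ a b c y 2 * cell w₁ a b c y 4 + 2 * cell w₁ a b c y 2 * cell w₁ a b c y 5 + cell w₁ a b c y 2 * cell w₁ a b c y 6 +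
        cell w₁ a b c y 2 * cell w₁ a b c y 10 + cell w₁ a b c y 3 * cell w₁ a b c y 5 + cell w₁ a b c y 3 * cell w₁ a b c y 6 +
        cell w₁ a b c y 4 * cell w₁ a b c y 6 + cell w₁ a b c y 5 * cell w₁ a b c y 6 + cell w₁ a b c y 5 * cell w₁ a b c y 7 +
        cell w₁ a b c y 6 * cell w₁ a b c y 7 + 2 * cell w₁ a b c y 6 * cell w₁ a b c y 8 + 2 * cell w₁ a b c y 6 * cell w₁ a b c y 9 +
        cell w₁ a b c y 6 * cell w₁ a b c y 10 + 2 * cell w₁ a b c y 8 * cell w₁ a b c y 11 + 2 * cell w₁ a b c y 9 * cell w₁ a b c y 11))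
    (hXby : 0 ≤ 2 * cell w₁ a b c y 0 * cell w₁ a b c y 8 + cell w₁ a b c y 0 * cell w₁ a b c y 10 + 2 * cell w₁ a b c y 0 * cell w₁ a b c y 11 +
        cell w₁ a b c y 0 * cell w₁ a b c y 13 + 2 * cell w₁ a b c y 0 * cell w₁ a b c y 14 - (cell w₁ a b c y 1 * cell w₁ a b c y 4 +
        cell w₁ a b c y 1 * cell w₁ a b c y 5 + 2 * cell w₁ a b c y 1 * cell w₁ a b c y 6 + cell w₁ a b c y 1 * cell w₁ a b c y 12 +
        cell w₁ a b c y 2 * cell w₁ a b c y 10 + cell w₁ a b c y 2 * cell w₁ a b c y 13 + cell w₁ a b c y 3 * cell w₁ a b c y 5 +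
        cell w₁ a b c y 3 * cell w₁ a b c y 6 + cell w₁ a b c y 4 * cell w₁ a b c y 5 + cell w₁ a b c y 5 * cell w₁ a b c y 6 +
        cell w₁ a b c y 5 * cell w₁ a b c y 7 + 2 * cell w₁ a b c y 5 * cell w₁ a b c y 11 + cell w₁ a b c y 5 * cell w₁ a b c y 12 +
        cell w₁ a b c y 6 * cell w₁ a b c y 7 + 2 * cell w₁ a b c y 9 * cell w₁ a b c y 11))
    (hXbc : 0 ≤ 2 * cell w₁ a b c y 0 * cell w₁ a b c y 9 + 2 * cell w₁ a b c y 0 * cell w₁ a b c y 10 + 2 * cell w₁ a b c y 0 * cell w₁ a b c y 11 +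
        2 * cell w₁ a b c y 0 * cell w₁ a b c y 12 + 2 * cell w₁ a b c y 0 * cell w₁ a b c y 14 - (2 * cell w₁ a b c y 1 * cell w₁ a b c y 4 +
        2 * cell w₁ a b c y 1 * cell w₁ a b c y 5 + 2 * cell w₁ a b c y 1 * cell w₁ a b c y 6 + 2 * cell w₁ a b c y 1 * cell w₁ a b c y 8 +
        cell w₁ a b c y 1 * cell w₁ a b c y 13 + 2 * cell w₁ a b c y 2 * cell w₁ a b c y 5 + 2 * cell w₁ a b c y 2 * cell w₁ a b c y 6 +
        cell w₁ a b c y 2 * cell w₁ a b c y 13 + 2 * cell w₁ a b c y 4 * cell w₁ a b c y 6 + 2 * cell w₁ a b c y 4 * cell w₁ a b c y 11 +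
        cell w₁ a b c y 5 * cell w₁ a b c y 7 + cell w₁ a b c y 6 * cell w₁ a b c y 7 + 2 * cell w₁ a b c y 6 * cell w₁ a b c y 8 +
        2 * cell w₁ a b c y 8 * cell w₁ a b c y 11)) :
    (2 * (cell w a b c y 11 * cell w a b c y 9 + cell w a b c y 11 * cell w a b c y 8 + cell w a b c y 6 * cell w a b c y 8 +
        cell w a b c y 6 * cell w a b c y 1 + cell w a b c y 1 * cell w a b c y 8) +
        (cell w a b c y 2 * cell w a b c y 13 + cell w a b c y 1 * cell w a b c y 13 + cell w a b c y 5 * cell w a b c y 12 +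
        cell w a b c y 1 * cell w a b c y 12 + cell w a b c y 6 * cell w a b c y 10 + cell w a b c y 6 * cell w a b c y 7 +
          cell w a b c y 2 * cell w a b c y 10 + cell w a b c y 5 * cell w a b c y 7) ≤
      2 * ((cell w a b c y 11 + cell w a b c y 14) * cell w a b c y 0)) ∧
    (0 ≤ 2 * cell w a b c y 0 * cell w a b c y 9 + 2 * cell w a b c y 0 * cell w a b c y 11 + cell w a b c y 0 * cell w a b c y 12 +
        cell w a b c y 0 * cell w a b c y 13 + 2 * cell w a b c y 0 * cell w a b c y 14 - (2 * cell w a b c y 1 * cell w a b c y 6 +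
        2 * cell w a b c y 1 * cell w a b c y 8 + cell w a b c y 1 * cell w a b c y 12 + cell w a b c y 1 * cell w a b c y 13 +
        cell w a b c y 2 * cell w a b c y 4 + 2 * cell w a b c y 2 * cell w a b c y 5 + cell w a b c y 2 * cell w a b c y 6 +
        cell w a b c y 2 * cell w a b c y 10 + cell w a b c y 3 * cell w a b c y 5 + cell w a b c y 3 * cell w a b c y 6 +
        cell w a b c y 4 * cell w a b c y 6 + cell w a b c y 5 * cell w a b c y 6 + cell w a b c y 5 * cell w a b c y 7 +
        cell w a b c y 6 * cell w a b c y 7 + 2 * cell w a b c y 6 * cell w a b c y 8 + 2 * cell w a b c y 6 * cell w a b c y 9 +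
        cell w a b c y 6 * cell w a b c y 10 + 2 * cell w a b c y 8 * cell w a b c y 11 + 2 * cell w a b c y 9 * cell w a b c y 11)) ∧
    (0 ≤ 2 * cell w a b c y 0 * cell w a b c y 8 + cell w a b c y 0 * cell w a b c y 10 + 2 * cell w a b c y 0 * cell w a b c y 11 +
        cell w a b c y 0 * cell w a b c y 13 + 2 * cell w a b c y 0 * cell w a b c y 14 - (cell w a b c y 1 * cell w a b c y 4 +
        cell w a b c y 1 * cell w a b c y 5 + 2 * cell w a b c y 1 * cell w a b c y 6 + cell w a b c y 1 * cell w a b c y 12 +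
        cell w a b c y 2 * cell w a b c y 10 + cell w a b c y 2 * cell w a b c y 13 + cell w a b c y 3 * cell w a b c y 5 +
        cell w a b c y 3 * cell w a b c y 6 + cell w a b c y 4 * cell w a b c y 5 + cell w a b c y 5 * cell w a b c y 6 +
        cell w a b c y 5 * cell w a b c y 7 + 2 * cell w a b c y 5 * cell w a b c y 11 + cell w a b c y 5 * cell w a b c y 12 +
        cell w a b c y 6 * cell w a b c y 7 + 2 * cell w a b c y 9 * cell w a b c y 11)) ∧
    (0 ≤ 2 * cell w a b c y 0 * cell w a b c y 9 + 2 * cell w a b c y 0 * cell w a b c y 10 + 2 * cell w a b c y 0 * cell w a b c y 11 +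
        2 * cell w a b c y 0 * cell w a b c y 12 + 2 * cell w a b c y 0 * cell w a b c y 14 - (2 * cell w a b c y 1 * cell w a b c y 4 +
        2 * cell w a b c y 1 * cell w a b c y 5 + 2 * cell w a b c y 1 * cell w a b c y 6 + 2 * cell w a b c y 1 * cell w a b c y 8 +
        cell w a b c y 1 * cell w a b c y 13 + 2 * cell w a b c y 2 * cell w a b c y 5 + 2 * cell w a b c y 2 * cell w a b c y 6 +
        cell w a b c y 2 * cell w a b c y 13 + 2 * cell w a b c y 4 * cell w a b c y 6 + 2 * cell w a b c y 4 * cell w a b c y 11 +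
        cell w a b c y 5 * cell w a b c y 7 + cell w a b c y 6 * cell w a b c y 7 + 2 * cell w a b c y 6 * cell w a b c y 8 +
        2 * cell w a b c y 8 * cell w a b c y 11)) :=
  have hRbc := portRow_bc_of_xcy w₁ a b c y hXcy
  have hRby := portRow_by_of_xbc w₁ a b c y hXbc
  ⟨q44_cells_of_portSplit h hW hXcy hXby hXbc hRbc hRby, xcy_cells_of_portSplit h hXcy hRbc hRby, xby_cells_of_portSplit h hXby hRbc,
    xbc_cells_of_portSplit h hXbc hRby⟩

end ConjWPort

end Summit.CriticalPhenomena.PercolationContinuityZ3.Theorems
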